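import Mathlib
import HarnessLib
import Summits.Ventures.LatticeQCDFlow.Scoring.RegenerativeMedianOfGroupsSigma
import Summits.Ventures.LatticeQCDFlow.Scoring.SampleMedianDeterministic

/-!
# The MEDIAN of the tour-group estimates is `s`-close to `π(f)` except with probability `e^{−K/8}`,
# once `m ≥ 16(ε σ²_f/s² + 1 − ε)` — the literal median statement, any start, any minorising law

HONEST FRAMING: exact (Metropolis-corrected) sampling algorithms for lattice gauge theory;
figures of merit are autocorrelation/cost numbers at stated couplings and volumes; no
continuum-physics claim.

Venture `LatticeQCDFlow` (cell pub-lqcd), topic `Scoring`; FANOUT row 8 (`s0-cpn-nemc`, GEN-17).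
NEW WORK of the cell, not a published result; no definition is introduced.  Composition of
`Scoring/RegenerativeMedianOfGroupsSigma.lean` (the count event `#{bad groups} ≥ K/2` has probability
`≤ e^{−K/8}` at the CLT scale) with the deterministic step `Scoring/SampleMedianDeterministic.lean`
(fewer than half far ⇒ every median close): for ANY measurable-or-not selection `M` of a median of
the `K` group estimates `A_0, …, A_{K−1}` (at least `K/2` of them `≥ M` and at least `K/2` of them
`≤ M`, pointwise), `P(s ≤ |M − π(f)|) ≤ e^{−K/8}` whenever `4(ε σ²_f/s² + 1 − ε)/m ≤ 1/4`.  This is the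
sentence the row's median certificates state in words, now typed.  Nothing is cited.

## Content (`0 < ε < 1`, `π` invariant, `κ(x,·) ≥ ε ν`, `|f| ≤ C`, any start; groups of `m ≥ 1` tours,
## `A_k` the group estimates, `M` any pointwise median of `A_0..A_{K−1}`)

* **`regenerative_median_confidence_sigma`** — `P(s ≤ |M − π(f)|) ≤ exp(−K/8)`.

NOT CLAIMED: a particular median convention (all are covered); optimal constants.
-/

noncomputable section

namespace Summit.Ventures.LatticeQCDFlow.Scoring

open MeasureTheory ProbabilityTheory Filter Finset Preorder Literature.Probability.MarkovChains
open scoped ENNReal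

section Median

variable {Ω : Type*} [MeasurableSpace Ω]
  {κ : Kernel Ω Ω} [IsMarkovKernel κ] {ν : Measure Ω} [IsProbabilityMeasure ν] {ε : ℝ≥0∞}
  {hmin : ∀ x {B : Set Ω}, MeasurableSet B → ε * ν B ≤ κ x B}
  (κs : Kernel (Ω × Bool) (Ω × Bool)) [IsMarkovKernel κs]
  (μs : Measure (Ω × Bool)) [IsProbabilityMeasure μs]

/-- **THE MEDIAN OF THE TOUR-GROUP ESTIMATES IS `s`-CLOSE, EXPONENTIALLY SURELY.**  With
`A_k = Σ_{i<m} Y_{k(m+1)+i+1} / Σ_{i<m} N_{k(m+1)+i+1}` the estimate of group `k` and `M` any function of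
the path that is, at every path, a median of `A_0, …, A_{K−1}`: if `4(e σ²_f/s² + (1 − e))/m ≤ 1/4` then
`P(s ≤ |M − π(f)|) ≤ exp(−K/8)`. -/
theorem regenerative_median_confidence_sigma {π : Measure Ω} [IsProbabilityMeasure π]
    (hπ : Kernel.Invariant κ π) (hε0 : 0 < ε) (hε : ε < 1)
    (hκs : ∀ p, κs p = (ε • ν).map (fun y : Ω => (y, true))
      + ((1 - ε) • Doeblin.residualKernel κ ν ε hmin p.1).map (fun y : Ω => (y, false)))
    {f : Ω → ℝ} (hf : Measurable f) {C : ℝ} (hC : ∀ x, |f x| ≤ C) {m : ℕ} (hm : 0 < m)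
    {s : ℝ} (hs : 0 < s)
    (hq : 4 * (ε.toReal * ((∫ y, (f y - ∫ z, f z ∂π) ^ 2 ∂π)
          + 2 * ∑' k, ∫ y, (f y - ∫ z, f z ∂π) * (kop κ)^[k + 1] (fun y => f y - ∫ z, f z ∂π) y ∂π)
          / s ^ 2 + (1 - ε.toReal)) / m ≤ 1 / 4) (K : ℕ)
    (M : (ℕ → Ω × Bool) → ℝ)
    (hlo : ∀ x, (K : ℝ) / 2 ≤ ∑ k ∈ Finset.range K, (if M x ≤
        (∑ i ∈ Finset.range m, ∑' u, (if (∑ s ∈ Finset.range u,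
          (if (x (s + 1)).2 then (1 : ℕ) else 0)) = k * (m + 1) + i + 1 then (1 : ℝ) else 0) * f (x u).1)
        / (∑ i ∈ Finset.range m, ∑' u, (if (∑ s ∈ Finset.range u,
          (if (x (s + 1)).2 then (1 : ℕ) else 0)) = k * (m + 1) + i + 1 then (1 : ℝ) else 0))
        then (1 : ℝ) else 0))
    (hhi : ∀ x, (K : ℝ) / 2 ≤ ∑ k ∈ Finset.range K, (if
        (∑ i ∈ Finset.range m, ∑' u, (if (∑ s ∈ Finset.range u,
          (if (x (s + 1)).2 then (1 : ℕ) else 0)) = k * (m + 1) + i + 1 then (1 : ℝ) else 0) * f (x u).1)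
        / (∑ i ∈ Finset.range m, ∑' u, (if (∑ s ∈ Finset.range u,
          (if (x (s + 1)).2 then (1 : ℕ) else 0)) = k * (m + 1) + i + 1 then (1 : ℝ) else 0)) ≤ M x
        then (1 : ℝ) else 0)) :
    (Kernel.trajMeasure (X := fun _ : ℕ => Ω × Bool) μs
        (fun n : ℕ => κs.comap (fun h : (i : ↥(Finset.Iic n)) → Ω × Bool =>
          h ⟨n, Finset.mem_Iic.2 le_rfl⟩) (measurable_pi_apply _))).real
      {x | s ≤ |M x - ∫ z, f z ∂π|} ≤ Real.exp (-((K : ℝ) / 8)) := by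
  set P := Kernel.trajMeasure (X := fun _ : ℕ => Ω × Bool) μs
      (fun n : ℕ => κs.comap (fun h : (i : ↥(Finset.Iic n)) → Ω × Bool =>
        h ⟨n, Finset.mem_Iic.2 le_rfl⟩) (measurable_pi_apply _)) with hP
  have h := regenerative_medianOfGroups_confidence_sigma κs μs (κ := κ) (ν := ν) (hmin := hmin) hπ
    hε0 hε hκs hf hC hm hs hq K
  rw [← hP] at h
  have h1 := measureReal_median_far_le P
    (fun (k : ℕ) (x : ℕ → Ω × Bool) => (∑ i ∈ Finset.range m, ∑' u, (if (∑ s ∈ Finset.range u,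
        (if (x (s + 1)).2 then (1 : ℕ) else 0)) = k * (m + 1) + i + 1 then (1 : ℝ) else 0) * f (x u).1)
      / (∑ i ∈ Finset.range m, ∑' u, (if (∑ s ∈ Finset.range u,
        (if (x (s + 1)).2 then (1 : ℕ) else 0)) = k * (m + 1) + i + 1 then (1 : ℝ) else 0)))
    M K (∫ z, f z ∂π) s hlo hhi
  exact h1.trans h

end Median

end Summit.Ventures.LatticeQCDFlow.Scoring

end
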